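import Summits.QuantumFields.BalabanUV.Beta.GAN24.T2DevConservationJunction
import Summits.QuantumFields.BalabanUV.Beta.GAN24.T2DevConservationDefectThree
import Summits.QuantumFields.BalabanUV.Beta.GAN24.T2UndressedCombJunction

/-!
# `BalabanUV.Beta.GAN24.T2DevConservationCapstone` — binder row G-an2-4 / (CONV-C), W-slot CT-W, route «WC-TL» ∕ «QR-LL» (RULINGS R-gan24p1-g24-1∕-2, R-gan24p1-g25-1), A-0 in
# DEVIATION FORM: **THE CAPSTONES — «T2Shape»(E), «T2Drift»(E), THE TWO W-SLOT ROWS (hW, hWall) OF THE COMB FAMILY AND ROAD FP's D1 LITERAL OF RECORD FROM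
# F2a-comb ∧ (C) ∧ (Q-D) ∧ (Q-D-rate) ONLY** — the displayed WC-TL rows are now EXACTLY the uniform shape (Q-D) and rate (Q-D-rate) of the orbit's dressing defect
# `(𝔇 − 1) T̃_m` (the object T-DL ∕ SLAVE-src ∕ ι-WIN ∕ (Q-R) ∕ (Q-L) bound), the symmetrised relative conservation law (C) and the undressed-kernel source row F2a-comb.

NOT IN PRINT; OUR BOOKKEEPING ([folklore] composition BY NAME, ZERO new content: `T2DevConservationDefectThree.exists_hH_hHr_three_of_defect_rows` ((Q-D) ∧ (Q-D-rate) ⟹ (H) ∧ (H-rate))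
∘ `T2DevConservationJunction.t2Drift_T2RecAt_three_of_F2a_C_H_Hr ∕ hW_hWall_WrecAt_three_of_F2a_C_H_Hr ∕ exists_allScalesSeq_JsRowD1Pin_of_F2a_C_H_Hr` ∘ leaf-04 g59's
`T2UndressedCombJunction.t2Shape_T2RecAt_three_of_F2a_C_H`; G-an2-4 formalisation swarm, leaf prover `b2b-balaban-gan24-formalise-leaf-01`, gen 63).  HONEST FRAMING (cell contract,
verbatim): «discharging `BetaPertH` makes Bałaban's UV stability UNCONDITIONAL — a real constructive-QFT result; it is NOT the continuum limit and NOT the Clay problem.»  HONEST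
DEPENDENCY (verbatim): «continuum YM on T⁴ ⇐ BetaPertH ∧ nine spine estimates (0/9 proved); BetaPertH ⇐ (D1) ∧ (D4) ∧ CAP+tail; G-an2-4 gates asym, D1 and NE2/3/4.»

THE FOUR ROWS ARE HYPOTHESES: F2a-comb (joint covariance ∧ bond-symmetrised ff charge zero of the undressed-kernel comb sources), (C) (an2 WANTED), (Q-D) ∕ (Q-D-rate) (the located
crux (Q-R)∕(Q-L) of «QR-LL» lives inside them; OPEN).  NOTHING of them is discharged here; NOT «W-slot closed», NOT «D1 closed»; NEVER «G-an2-4 closed» as (CONV-C); NOT D1, NOT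
`BetaPertH`, NOT continuum, NOT Clay.  0 cited facts, 0 `def`, 0 `def … : Prop`, 0 sorry.  2026-08-22.
-/

noncomputable section

open Finset
open scoped BigOperators
open Literature.MathematicalPhysics.QuantumFieldTheory
open Literature.MathematicalPhysics.QuantumFieldTheory.Balaban1983to89
open Literature.MathematicalPhysics.QuantumFieldTheory.Balaban1983to89.Beta
open RemainderConstAllScales (AllScalesSeq)
open ExpKernelCalculus (MKer Decays BiLoc VertexFamily VertexFamily₂ shiftK)
open OneStepResolventKernel (Fib LocStencil)
open OneStepKernelFamily (KInvStep TbalOf)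
open AffineAveraging (box toSite)
open AveragingContoursRooted (ctrOff ctrOff_mem_box)
open AveragingMixedJetTables (mixFFAt)
open WilsonVertex2Sym (wsym22)
open SecondOrderResponse (W2SymOfK)
open BalabanCompositeJets (LocStencil₂)
open BalabanStepJetsSucc (mmRead)
open BalabanStepW2 (K3OfK M2Of)
open Summit.QuantumFields.BalabanUV.Beta.HessKerDressedUnits (unitK unitS unitW)
open Summit.QuantumFields.BalabanUV.Beta.SecondOrderUnits (unitM unitS₂ unitM₂)
open Summit.QuantumFields.BalabanUV.Beta.AxialDressingRooted (coDressKBmAt dressKBmAt coProjBmAtK)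
open Summit.QuantumFields.BalabanUV.Beta.SpineRooted (T2RecOf T2RecAt SpureRecAt M1At WrecAt)
open Summit.QuantumFields.BalabanUV.Beta.SecondOrderSocketIdentification (vh₂SAn1 vh₂SAn1_inl_inl vh₂SAn1_inr_inr)
open Summit.QuantumFields.BalabanUV.Beta.SecondOrderTableLawEnd (locStencil₂_vh₂SAn1 vh₂SAn1_translate)
open Summit.QuantumFields.BalabanUV.Beta.RowD1JointEnd (JsRowD1Pin)
open Summit.QuantumFields.BalabanUV.Beta.GAN24.CombesThomas (sfStep smStep)
open Summit.QuantumFields.BalabanUV.Beta.GAN24.T2RecursionAffine (lin4)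
open Summit.QuantumFields.BalabanUV.Beta.GAN24.BiStencilZeroMode (Tab zmode)
open Summit.QuantumFields.BalabanUV.Beta.GAN24.T2UndressedCombJunction (t2Shape_T2RecAt_three_of_F2a_C_H)
open Summit.QuantumFields.BalabanUV.Beta.GAN24.T2DevConservationDefectThree (exists_hH_hHr_three_of_defect_rows)
open Summit.QuantumFields.BalabanUV.Beta.GAN24.T2DevConservationJunction (t2Drift_T2RecAt_three_of_F2a_C_H_Hr hW_hWall_WrecAt_three_of_F2a_C_H_Hr
  exists_allScalesSeq_JsRowD1Pin_of_F2a_C_H_Hr)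

namespace Summit.QuantumFields.BalabanUV.Beta.GAN24.T2DevConservationCapstone

variable {Lc : ℕ} [NeZero Lc] {r : Fin (3 + 1) → ℕ}

/-! ## §1 Generic in-block root -/

/-- NOT IN PRINT; OUR PROOF ATTEMPT ([folklore] leaf-04's `T2UndressedCombJunction.t2Shape_T2RecAt_three_of_F2a_C_H` with (H) := `exists_hH_hHr_three_of_defect_rows`.1).  **«T2Shape» OF
an2's COMB T₂ TOWER AT `d = 3` FROM F2a-comb ∧ (C) ∧ (Q-D) ∧ (Q-D-rate)** (`2 ≤ Lc`, in-block root, `cE = Lc⁴`, every `cVH cΛ cB Tc`, the EXACT pin `cE₂ = Lc⁸`, every jointly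
covariant off-diagonal `LocStencil₂` border): `∃ C δ, 0 < δ ∧ ∀ n, LocStencil₂ (T̃_n) C δ`.  CONDITIONAL on the four displayed rows; NEVER «G-an2-4 closed» as (CONV-C); NOT D1, NOT
`BetaPertH`, NOT continuum, NOT Clay. -/
theorem t2Shape_T2RecAt_three_of_F2a_C_QD (hLc : 2 ≤ Lc) (hr : r ∈ box (3 + 1) Lc) {cE : ℝ} (hcE : cE = (Lc : ℝ) ^ (3 + 1)) (cVH cΛ cE₂ cB : ℝ)
    (Tc : Fin 4 → Fin 4 → Fin 4 → Fin 4 → ℝ) {vh₂S : Tab 3}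
    (hBff : ∀ κ u κ' u' x z (α β : Fin (3 + 1)), vh₂S κ u κ' u' x z (Sum.inl α) (Sum.inl β) = 0)
    (hBmm : ∀ κ u κ' u' x z (μ ν : Fin (3 + 1)), vh₂S κ u κ' u' x z (Sum.inr μ) (Sum.inr ν) = 0)
    {CB δB : ℝ} (hB : LocStencil₂ vh₂S CB δB) (hδB : 0 < δB)
    (hBt : ∀ (κ : Fin (3 + 1)) (u : Fin (3 + 1) → ℤ) (κ' : Fin (3 + 1)) (u' t : Fin (3 + 1) → ℤ),
      vh₂S κ (u + (Lc : ℤ) • t) κ' (u' + (Lc : ℤ) • t) = shiftK (-((Lc : ℤ) • t)) (vh₂S κ u κ' u'))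
    (hpinEq : cE₂ = (Lc : ℝ) ^ (2 * (3 + 1)))
        (hZ : ∀ i : ℕ,
      (∀ κ u κ' u' t,
          (cE₂ * (Lc : ℝ) ^ (2 * (3 + 1))) •
              mmRead Lc (K3OfK (unitK (sfStep Lc i) (smStep 3 Lc i) (KInvStep (d := 3) Lc i)) Lc
              (unitS (sfStep Lc i) (smStep 3 Lc i) (SpureRecAt 3 Lc (toSite r) cE cVH cΛ i)) (unitM (sfStep Lc i) (smStep 3 Lc i) (M1At 3 Lc (toSite r) cΛ i))
              (W2SymOfK (unitK (sfStep Lc i) (smStep 3 Lc i) (KInvStep (d := 3) Lc i)) Lc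
                (unitS (sfStep Lc i) (smStep 3 Lc i) (SpureRecAt 3 Lc (toSite r) cE cVH cΛ i)) (unitM (sfStep Lc i) (smStep 3 Lc i) (M1At 3 Lc (toSite r) cΛ i)) 0
                (unitM₂ (sfStep Lc i) (smStep 3 Lc i) (M2Of 3 Lc (mixFFAt (toSite r) Lc) i))) κ (u + (Lc : ℤ) • t) κ' (u' + (Lc : ℤ) • t)) + cB • vh₂S κ (u + (Lc : ℤ) • t) κ' (u' + (Lc : ℤ) • t) =
        shiftK (-((Lc : ℤ) • t)) ((cE₂ * (Lc : ℝ) ^ (2 * (3 + 1))) •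
              mmRead Lc (K3OfK (unitK (sfStep Lc i) (smStep 3 Lc i) (KInvStep (d := 3) Lc i)) Lc
              (unitS (sfStep Lc i) (smStep 3 Lc i) (SpureRecAt 3 Lc (toSite r) cE cVH cΛ i)) (unitM (sfStep Lc i) (smStep 3 Lc i) (M1At 3 Lc (toSite r) cΛ i))
              (W2SymOfK (unitK (sfStep Lc i) (smStep 3 Lc i) (KInvStep (d := 3) Lc i)) Lc
                (unitS (sfStep Lc i) (smStep 3 Lc i) (SpureRecAt 3 Lc (toSite r) cE cVH cΛ i)) (unitM (sfStep Lc i) (smStep 3 Lc i) (M1At 3 Lc (toSite r) cΛ i)) 0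
                (unitM₂ (sfStep Lc i) (smStep 3 Lc i) (M2Of 3 Lc (mixFFAt (toSite r) Lc) i))) κ u κ' u') + cB • vh₂S κ u κ' u')) ∧
      (∀ κ κ' κ₁ κ₂,
        zmode Lc (fun κ u κ' u' => (cE₂ * (Lc : ℝ) ^ (2 * (3 + 1))) •
              mmRead Lc (K3OfK (unitK (sfStep Lc i) (smStep 3 Lc i) (KInvStep (d := 3) Lc i)) Lc
              (unitS (sfStep Lc i) (smStep 3 Lc i) (SpureRecAt 3 Lc (toSite r) cE cVH cΛ i)) (unitM (sfStep Lc i) (smStep 3 Lc i) (M1At 3 Lc (toSite r) cΛ i))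
              (W2SymOfK (unitK (sfStep Lc i) (smStep 3 Lc i) (KInvStep (d := 3) Lc i)) Lc
                (unitS (sfStep Lc i) (smStep 3 Lc i) (SpureRecAt 3 Lc (toSite r) cE cVH cΛ i)) (unitM (sfStep Lc i) (smStep 3 Lc i) (M1At 3 Lc (toSite r) cΛ i)) 0
                (unitM₂ (sfStep Lc i) (smStep 3 Lc i) (M2Of 3 Lc (mixFFAt (toSite r) Lc) i))) κ u κ' u') + cB • vh₂S κ u κ' u') κ κ' (Sum.inl κ₁) (Sum.inl κ₂) +
        zmode Lc (fun κ u κ' u' => (cE₂ * (Lc : ℝ) ^ (2 * (3 + 1))) •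
              mmRead Lc (K3OfK (unitK (sfStep Lc i) (smStep 3 Lc i) (KInvStep (d := 3) Lc i)) Lc
              (unitS (sfStep Lc i) (smStep 3 Lc i) (SpureRecAt 3 Lc (toSite r) cE cVH cΛ i)) (unitM (sfStep Lc i) (smStep 3 Lc i) (M1At 3 Lc (toSite r) cΛ i))
              (W2SymOfK (unitK (sfStep Lc i) (smStep 3 Lc i) (KInvStep (d := 3) Lc i)) Lc
                (unitS (sfStep Lc i) (smStep 3 Lc i) (SpureRecAt 3 Lc (toSite r) cE cVH cΛ i)) (unitM (sfStep Lc i) (smStep 3 Lc i) (M1At 3 Lc (toSite r) cΛ i)) 0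
                (unitM₂ (sfStep Lc i) (smStep 3 Lc i) (M2Of 3 Lc (mixFFAt (toSite r) Lc) i))) κ u κ' u') + cB • vh₂S κ u κ' u') κ' κ (Sum.inl κ₁) (Sum.inl κ₂) = 0))
    {CY δY CY' θY δY' : ℝ}
    (hC : ∀ (i : ℕ) (κ κ' κ₁ κ₂ : Fin (3 + 1)),
      zmode Lc (unitS₂ (sfStep Lc i) (smStep 3 Lc i) (T2RecAt 3 Lc (toSite r) cE cVH cΛ cE₂ cB Tc vh₂S (mixFFAt (toSite r) Lc) i)) κ κ' (Sum.inl κ₁) (Sum.inl κ₂)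
          + zmode Lc (unitS₂ (sfStep Lc i) (smStep 3 Lc i) (T2RecAt 3 Lc (toSite r) cE cVH cΛ cE₂ cB Tc vh₂S (mixFFAt (toSite r) Lc) i)) κ' κ (Sum.inl κ₁) (Sum.inl κ₂)
        = zmode Lc (unitS₂ (sfStep Lc i) (smStep 3 Lc i) (T2RecOf 3 Lc (fun j => KInvStep (d := 3) Lc j) (SpureRecAt 3 Lc (toSite r) cE cVH cΛ) (M1At 3 Lc (toSite r) cΛ) cE₂ cB Tc vh₂S (mixFFAt (toSite r) Lc) i)) κ κ' (Sum.inl κ₁) (Sum.inl κ₂)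
          + zmode Lc (unitS₂ (sfStep Lc i) (smStep 3 Lc i) (T2RecOf 3 Lc (fun j => KInvStep (d := 3) Lc j) (SpureRecAt 3 Lc (toSite r) cE cVH cΛ) (M1At 3 Lc (toSite r) cΛ) cE₂ cB Tc vh₂S (mixFFAt (toSite r) Lc) i)) κ' κ (Sum.inl κ₁) (Sum.inl κ₂))
    (hY : ∀ m : ℕ, LocStencil₂ ((fun κ u κ' u' => dressKBmAt (toSite r) Lc (coProjBmAtK (toSite r) Lc (fun κ₁ u₁ => coProjBmAtK (toSite r) Lc
            ((unitS₂ (sfStep Lc m) (smStep 3 Lc m) (T2RecAt 3 Lc (toSite r) cE cVH cΛ cE₂ cB Tc vh₂S (mixFFAt (toSite r) Lc) m)) κ₁ u₁) κ' u') κ u)) -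
          (unitS₂ (sfStep Lc m) (smStep 3 Lc m) (T2RecAt 3 Lc (toSite r) cE cVH cΛ cE₂ cB Tc vh₂S (mixFFAt (toSite r) Lc) m))) CY δY) (hδY : 0 < δY)
    (hYr : ∀ m : ℕ, LocStencil₂ (((fun κ u κ' u' => dressKBmAt (toSite r) Lc (coProjBmAtK (toSite r) Lc (fun κ₁ u₁ => coProjBmAtK (toSite r) Lc
            ((unitS₂ (sfStep Lc (m + 1)) (smStep 3 Lc (m + 1)) (T2RecAt 3 Lc (toSite r) cE cVH cΛ cE₂ cB Tc vh₂S (mixFFAt (toSite r) Lc) (m + 1))) κ₁ u₁) κ' u') κ u)) -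
          (unitS₂ (sfStep Lc (m + 1)) (smStep 3 Lc (m + 1)) (T2RecAt 3 Lc (toSite r) cE cVH cΛ cE₂ cB Tc vh₂S (mixFFAt (toSite r) Lc) (m + 1)))) -
      ((fun κ u κ' u' => dressKBmAt (toSite r) Lc (coProjBmAtK (toSite r) Lc (fun κ₁ u₁ => coProjBmAtK (toSite r) Lc
            ((unitS₂ (sfStep Lc m) (smStep 3 Lc m) (T2RecAt 3 Lc (toSite r) cE cVH cΛ cE₂ cB Tc vh₂S (mixFFAt (toSite r) Lc) m)) κ₁ u₁) κ' u') κ u)) -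
          (unitS₂ (sfStep Lc m) (smStep 3 Lc m) (T2RecAt 3 Lc (toSite r) cE cVH cΛ cE₂ cB Tc vh₂S (mixFFAt (toSite r) Lc) m)))) (CY' * θY ^ m) δY') (hθY0 : 0 ≤ θY) (hθY1 : θY < 1) (hδY' : 0 < δY') :
    ∃ C δ : ℝ, 0 < δ ∧ ∀ n : ℕ, LocStencil₂ (unitS₂ (sfStep Lc n) (smStep 3 Lc n) (T2RecAt 3 Lc (toSite r) cE cVH cΛ cE₂ cB Tc vh₂S (mixFFAt (toSite r) Lc) n)) C δ := by
  have hpin : |cE₂| ≤ (Lc : ℝ) ^ (2 * (3 + 1)) := by rw [hpinEq, abs_of_nonneg (by positivity)]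
  obtain ⟨Ch, δh, Ch', θh, δh', hδh, -, -, -, hH, -⟩ := exists_hH_hHr_three_of_defect_rows hLc hr hcE cVH cΛ cE₂ cB Tc hB hδB hY hδY hYr hθY0 hθY1 hδY'
  exact t2Shape_T2RecAt_three_of_F2a_C_H hLc hr hcE cVH cΛ cE₂ cB Tc hBff hBmm hB hδB hBt hpin hZ hδh hC hH

/-- NOT IN PRINT; OUR PROOF ATTEMPT ([folklore] `T2DevConservationJunction.t2Drift_T2RecAt_three_of_F2a_C_H_Hr` with (H) ∧ (H-rate) := `exists_hH_hHr_three_of_defect_rows`).  **«T2Drift» OF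
an2's COMB T₂ TOWER AT `d = 3` FROM F2a-comb ∧ (C) ∧ (Q-D) ∧ (Q-D-rate)** (same data): `∃ c ϑ δ, 0 ≤ c ∧ 0 < ϑ ∧ ϑ < 1 ∧ 0 < δ ∧ ∀ n, LocStencil₂ (T̃_{n+1} − T̃_n) (c·ϑ^n) δ`.
CONDITIONAL; NEVER «G-an2-4 closed» as (CONV-C); NOT D1, NOT `BetaPertH`, NOT continuum, NOT Clay. -/
theorem t2Drift_T2RecAt_three_of_F2a_C_QD (hLc : 2 ≤ Lc) (hr : r ∈ box (3 + 1) Lc) {cE : ℝ} (hcE : cE = (Lc : ℝ) ^ (3 + 1)) (cVH cΛ cE₂ cB : ℝ)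
    (Tc : Fin 4 → Fin 4 → Fin 4 → Fin 4 → ℝ) {vh₂S : Tab 3}
    (hBff : ∀ κ u κ' u' x z (α β : Fin (3 + 1)), vh₂S κ u κ' u' x z (Sum.inl α) (Sum.inl β) = 0)
    (hBmm : ∀ κ u κ' u' x z (μ ν : Fin (3 + 1)), vh₂S κ u κ' u' x z (Sum.inr μ) (Sum.inr ν) = 0)
    {CB δB : ℝ} (hB : LocStencil₂ vh₂S CB δB) (hδB : 0 < δB)
    (hBt : ∀ (κ : Fin (3 + 1)) (u : Fin (3 + 1) → ℤ) (κ' : Fin (3 + 1)) (u' t : Fin (3 + 1) → ℤ),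
      vh₂S κ (u + (Lc : ℤ) • t) κ' (u' + (Lc : ℤ) • t) = shiftK (-((Lc : ℤ) • t)) (vh₂S κ u κ' u'))
    (hpinEq : cE₂ = (Lc : ℝ) ^ (2 * (3 + 1)))
        (hZ : ∀ i : ℕ,
      (∀ κ u κ' u' t,
          (cE₂ * (Lc : ℝ) ^ (2 * (3 + 1))) •
              mmRead Lc (K3OfK (unitK (sfStep Lc i) (smStep 3 Lc i) (KInvStep (d := 3) Lc i)) Lc
              (unitS (sfStep Lc i) (smStep 3 Lc i) (SpureRecAt 3 Lc (toSite r) cE cVH cΛ i)) (unitM (sfStep Lc i) (smStep 3 Lc i) (M1At 3 Lc (toSite r) cΛ i))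
              (W2SymOfK (unitK (sfStep Lc i) (smStep 3 Lc i) (KInvStep (d := 3) Lc i)) Lc
                (unitS (sfStep Lc i) (smStep 3 Lc i) (SpureRecAt 3 Lc (toSite r) cE cVH cΛ i)) (unitM (sfStep Lc i) (smStep 3 Lc i) (M1At 3 Lc (toSite r) cΛ i)) 0
                (unitM₂ (sfStep Lc i) (smStep 3 Lc i) (M2Of 3 Lc (mixFFAt (toSite r) Lc) i))) κ (u + (Lc : ℤ) • t) κ' (u' + (Lc : ℤ) • t)) + cB • vh₂S κ (u + (Lc : ℤ) • t) κ' (u' + (Lc : ℤ) • t) =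
        shiftK (-((Lc : ℤ) • t)) ((cE₂ * (Lc : ℝ) ^ (2 * (3 + 1))) •
              mmRead Lc (K3OfK (unitK (sfStep Lc i) (smStep 3 Lc i) (KInvStep (d := 3) Lc i)) Lc
              (unitS (sfStep Lc i) (smStep 3 Lc i) (SpureRecAt 3 Lc (toSite r) cE cVH cΛ i)) (unitM (sfStep Lc i) (smStep 3 Lc i) (M1At 3 Lc (toSite r) cΛ i))
              (W2SymOfK (unitK (sfStep Lc i) (smStep 3 Lc i) (KInvStep (d := 3) Lc i)) Lc
                (unitS (sfStep Lc i) (smStep 3 Lc i) (SpureRecAt 3 Lc (toSite r) cE cVH cΛ i)) (unitM (sfStep Lc i) (smStep 3 Lc i) (M1At 3 Lc (toSite r) cΛ i)) 0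
                (unitM₂ (sfStep Lc i) (smStep 3 Lc i) (M2Of 3 Lc (mixFFAt (toSite r) Lc) i))) κ u κ' u') + cB • vh₂S κ u κ' u')) ∧
      (∀ κ κ' κ₁ κ₂,
        zmode Lc (fun κ u κ' u' => (cE₂ * (Lc : ℝ) ^ (2 * (3 + 1))) •
              mmRead Lc (K3OfK (unitK (sfStep Lc i) (smStep 3 Lc i) (KInvStep (d := 3) Lc i)) Lc
              (unitS (sfStep Lc i) (smStep 3 Lc i) (SpureRecAt 3 Lc (toSite r) cE cVH cΛ i)) (unitM (sfStep Lc i) (smStep 3 Lc i) (M1At 3 Lc (toSite r) cΛ i))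
              (W2SymOfK (unitK (sfStep Lc i) (smStep 3 Lc i) (KInvStep (d := 3) Lc i)) Lc
                (unitS (sfStep Lc i) (smStep 3 Lc i) (SpureRecAt 3 Lc (toSite r) cE cVH cΛ i)) (unitM (sfStep Lc i) (smStep 3 Lc i) (M1At 3 Lc (toSite r) cΛ i)) 0
                (unitM₂ (sfStep Lc i) (smStep 3 Lc i) (M2Of 3 Lc (mixFFAt (toSite r) Lc) i))) κ u κ' u') + cB • vh₂S κ u κ' u') κ κ' (Sum.inl κ₁) (Sum.inl κ₂) +
        zmode Lc (fun κ u κ' u' => (cE₂ * (Lc : ℝ) ^ (2 * (3 + 1))) •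
              mmRead Lc (K3OfK (unitK (sfStep Lc i) (smStep 3 Lc i) (KInvStep (d := 3) Lc i)) Lc
              (unitS (sfStep Lc i) (smStep 3 Lc i) (SpureRecAt 3 Lc (toSite r) cE cVH cΛ i)) (unitM (sfStep Lc i) (smStep 3 Lc i) (M1At 3 Lc (toSite r) cΛ i))
              (W2SymOfK (unitK (sfStep Lc i) (smStep 3 Lc i) (KInvStep (d := 3) Lc i)) Lc
                (unitS (sfStep Lc i) (smStep 3 Lc i) (SpureRecAt 3 Lc (toSite r) cE cVH cΛ i)) (unitM (sfStep Lc i) (smStep 3 Lc i) (M1At 3 Lc (toSite r) cΛ i)) 0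
                (unitM₂ (sfStep Lc i) (smStep 3 Lc i) (M2Of 3 Lc (mixFFAt (toSite r) Lc) i))) κ u κ' u') + cB • vh₂S κ u κ' u') κ' κ (Sum.inl κ₁) (Sum.inl κ₂) = 0))
    {CY δY CY' θY δY' : ℝ}
    (hC : ∀ (i : ℕ) (κ κ' κ₁ κ₂ : Fin (3 + 1)),
      zmode Lc (unitS₂ (sfStep Lc i) (smStep 3 Lc i) (T2RecAt 3 Lc (toSite r) cE cVH cΛ cE₂ cB Tc vh₂S (mixFFAt (toSite r) Lc) i)) κ κ' (Sum.inl κ₁) (Sum.inl κ₂)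
          + zmode Lc (unitS₂ (sfStep Lc i) (smStep 3 Lc i) (T2RecAt 3 Lc (toSite r) cE cVH cΛ cE₂ cB Tc vh₂S (mixFFAt (toSite r) Lc) i)) κ' κ (Sum.inl κ₁) (Sum.inl κ₂)
        = zmode Lc (unitS₂ (sfStep Lc i) (smStep 3 Lc i) (T2RecOf 3 Lc (fun j => KInvStep (d := 3) Lc j) (SpureRecAt 3 Lc (toSite r) cE cVH cΛ) (M1At 3 Lc (toSite r) cΛ) cE₂ cB Tc vh₂S (mixFFAt (toSite r) Lc) i)) κ κ' (Sum.inl κ₁) (Sum.inl κ₂)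
          + zmode Lc (unitS₂ (sfStep Lc i) (smStep 3 Lc i) (T2RecOf 3 Lc (fun j => KInvStep (d := 3) Lc j) (SpureRecAt 3 Lc (toSite r) cE cVH cΛ) (M1At 3 Lc (toSite r) cΛ) cE₂ cB Tc vh₂S (mixFFAt (toSite r) Lc) i)) κ' κ (Sum.inl κ₁) (Sum.inl κ₂))
    (hY : ∀ m : ℕ, LocStencil₂ ((fun κ u κ' u' => dressKBmAt (toSite r) Lc (coProjBmAtK (toSite r) Lc (fun κ₁ u₁ => coProjBmAtK (toSite r) Lc
            ((unitS₂ (sfStep Lc m) (smStep 3 Lc m) (T2RecAt 3 Lc (toSite r) cE cVH cΛ cE₂ cB Tc vh₂S (mixFFAt (toSite r) Lc) m)) κ₁ u₁) κ' u') κ u)) -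
          (unitS₂ (sfStep Lc m) (smStep 3 Lc m) (T2RecAt 3 Lc (toSite r) cE cVH cΛ cE₂ cB Tc vh₂S (mixFFAt (toSite r) Lc) m))) CY δY) (hδY : 0 < δY)
    (hYr : ∀ m : ℕ, LocStencil₂ (((fun κ u κ' u' => dressKBmAt (toSite r) Lc (coProjBmAtK (toSite r) Lc (fun κ₁ u₁ => coProjBmAtK (toSite r) Lc
            ((unitS₂ (sfStep Lc (m + 1)) (smStep 3 Lc (m + 1)) (T2RecAt 3 Lc (toSite r) cE cVH cΛ cE₂ cB Tc vh₂S (mixFFAt (toSite r) Lc) (m + 1))) κ₁ u₁) κ' u') κ u)) -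
          (unitS₂ (sfStep Lc (m + 1)) (smStep 3 Lc (m + 1)) (T2RecAt 3 Lc (toSite r) cE cVH cΛ cE₂ cB Tc vh₂S (mixFFAt (toSite r) Lc) (m + 1)))) -
      ((fun κ u κ' u' => dressKBmAt (toSite r) Lc (coProjBmAtK (toSite r) Lc (fun κ₁ u₁ => coProjBmAtK (toSite r) Lc
            ((unitS₂ (sfStep Lc m) (smStep 3 Lc m) (T2RecAt 3 Lc (toSite r) cE cVH cΛ cE₂ cB Tc vh₂S (mixFFAt (toSite r) Lc) m)) κ₁ u₁) κ' u') κ u)) -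
          (unitS₂ (sfStep Lc m) (smStep 3 Lc m) (T2RecAt 3 Lc (toSite r) cE cVH cΛ cE₂ cB Tc vh₂S (mixFFAt (toSite r) Lc) m)))) (CY' * θY ^ m) δY') (hθY0 : 0 ≤ θY) (hθY1 : θY < 1) (hδY' : 0 < δY') :
    ∃ c ϑ δ : ℝ, 0 ≤ c ∧ 0 < ϑ ∧ ϑ < 1 ∧ 0 < δ ∧
      ∀ n : ℕ, LocStencil₂ ((unitS₂ (sfStep Lc (n + 1)) (smStep 3 Lc (n + 1)) (T2RecAt 3 Lc (toSite r) cE cVH cΛ cE₂ cB Tc vh₂S (mixFFAt (toSite r) Lc) (n + 1))) - (unitS₂ (sfStep Lc n) (smStep 3 Lc n) (T2RecAt 3 Lc (toSite r) cE cVH cΛ cE₂ cB Tc vh₂S (mixFFAt (toSite r) Lc) n))) (c * ϑ ^ n) δ := by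
  obtain ⟨Ch, δh, Ch', θh, δh', hδh, hθh0, hθh1, hδh', hH, hHr⟩ := exists_hH_hHr_three_of_defect_rows hLc hr hcE cVH cΛ cE₂ cB Tc hB hδB hY hδY hYr hθY0 hθY1 hδY'
  exact t2Drift_T2RecAt_three_of_F2a_C_H_Hr hLc hr hcE cVH cΛ cE₂ cB Tc hBff hBmm hB hδB hBt hpinEq hZ hδh hC hH hHr hθh0 hθh1 hδh'

/-- NOT IN PRINT; OUR PROOF ATTEMPT ([folklore] `T2DevConservationJunction.hW_hWall_WrecAt_three_of_F2a_C_H_Hr` likewise).  **THE TWO W-SLOT ROWS (hW, hWall) OF THE `d = 3` COMB FAMILY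
FROM F2a-comb ∧ (C) ∧ (Q-D) ∧ (Q-D-rate)** (same data).  The S-slot rows, the dressed K-rows, the multiplier ∕ mixed tables are TREE theorems inside p2's socket.  CONDITIONAL; NOT
«W-slot closed»; NEVER «G-an2-4 closed» as (CONV-C); NOT D1, NOT `BetaPertH`, NOT continuum, NOT Clay. -/
theorem hW_hWall_WrecAt_three_of_F2a_C_QD (hLc : 2 ≤ Lc) (hr : r ∈ box (3 + 1) Lc) {cE : ℝ} (hcE : cE = (Lc : ℝ) ^ (3 + 1)) (cVH cΛ cE₂ cB : ℝ)
    (Tc : Fin 4 → Fin 4 → Fin 4 → Fin 4 → ℝ) {vh₂S : Tab 3}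
    (hBff : ∀ κ u κ' u' x z (α β : Fin (3 + 1)), vh₂S κ u κ' u' x z (Sum.inl α) (Sum.inl β) = 0)
    (hBmm : ∀ κ u κ' u' x z (μ ν : Fin (3 + 1)), vh₂S κ u κ' u' x z (Sum.inr μ) (Sum.inr ν) = 0)
    {CB δB : ℝ} (hB : LocStencil₂ vh₂S CB δB) (hδB : 0 < δB)
    (hBt : ∀ (κ : Fin (3 + 1)) (u : Fin (3 + 1) → ℤ) (κ' : Fin (3 + 1)) (u' t : Fin (3 + 1) → ℤ),
      vh₂S κ (u + (Lc : ℤ) • t) κ' (u' + (Lc : ℤ) • t) = shiftK (-((Lc : ℤ) • t)) (vh₂S κ u κ' u'))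
    (hpinEq : cE₂ = (Lc : ℝ) ^ (2 * (3 + 1)))
        (hZ : ∀ i : ℕ,
      (∀ κ u κ' u' t,
          (cE₂ * (Lc : ℝ) ^ (2 * (3 + 1))) •
              mmRead Lc (K3OfK (unitK (sfStep Lc i) (smStep 3 Lc i) (KInvStep (d := 3) Lc i)) Lc
              (unitS (sfStep Lc i) (smStep 3 Lc i) (SpureRecAt 3 Lc (toSite r) cE cVH cΛ i)) (unitM (sfStep Lc i) (smStep 3 Lc i) (M1At 3 Lc (toSite r) cΛ i))
              (W2SymOfK (unitK (sfStep Lc i) (smStep 3 Lc i) (KInvStep (d := 3) Lc i)) Lc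
                (unitS (sfStep Lc i) (smStep 3 Lc i) (SpureRecAt 3 Lc (toSite r) cE cVH cΛ i)) (unitM (sfStep Lc i) (smStep 3 Lc i) (M1At 3 Lc (toSite r) cΛ i)) 0
                (unitM₂ (sfStep Lc i) (smStep 3 Lc i) (M2Of 3 Lc (mixFFAt (toSite r) Lc) i))) κ (u + (Lc : ℤ) • t) κ' (u' + (Lc : ℤ) • t)) + cB • vh₂S κ (u + (Lc : ℤ) • t) κ' (u' + (Lc : ℤ) • t) =
        shiftK (-((Lc : ℤ) • t)) ((cE₂ * (Lc : ℝ) ^ (2 * (3 + 1))) •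
              mmRead Lc (K3OfK (unitK (sfStep Lc i) (smStep 3 Lc i) (KInvStep (d := 3) Lc i)) Lc
              (unitS (sfStep Lc i) (smStep 3 Lc i) (SpureRecAt 3 Lc (toSite r) cE cVH cΛ i)) (unitM (sfStep Lc i) (smStep 3 Lc i) (M1At 3 Lc (toSite r) cΛ i))
              (W2SymOfK (unitK (sfStep Lc i) (smStep 3 Lc i) (KInvStep (d := 3) Lc i)) Lc
                (unitS (sfStep Lc i) (smStep 3 Lc i) (SpureRecAt 3 Lc (toSite r) cE cVH cΛ i)) (unitM (sfStep Lc i) (smStep 3 Lc i) (M1At 3 Lc (toSite r) cΛ i)) 0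
                (unitM₂ (sfStep Lc i) (smStep 3 Lc i) (M2Of 3 Lc (mixFFAt (toSite r) Lc) i))) κ u κ' u') + cB • vh₂S κ u κ' u')) ∧
      (∀ κ κ' κ₁ κ₂,
        zmode Lc (fun κ u κ' u' => (cE₂ * (Lc : ℝ) ^ (2 * (3 + 1))) •
              mmRead Lc (K3OfK (unitK (sfStep Lc i) (smStep 3 Lc i) (KInvStep (d := 3) Lc i)) Lc
              (unitS (sfStep Lc i) (smStep 3 Lc i) (SpureRecAt 3 Lc (toSite r) cE cVH cΛ i)) (unitM (sfStep Lc i) (smStep 3 Lc i) (M1At 3 Lc (toSite r) cΛ i))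
              (W2SymOfK (unitK (sfStep Lc i) (smStep 3 Lc i) (KInvStep (d := 3) Lc i)) Lc
                (unitS (sfStep Lc i) (smStep 3 Lc i) (SpureRecAt 3 Lc (toSite r) cE cVH cΛ i)) (unitM (sfStep Lc i) (smStep 3 Lc i) (M1At 3 Lc (toSite r) cΛ i)) 0
                (unitM₂ (sfStep Lc i) (smStep 3 Lc i) (M2Of 3 Lc (mixFFAt (toSite r) Lc) i))) κ u κ' u') + cB • vh₂S κ u κ' u') κ κ' (Sum.inl κ₁) (Sum.inl κ₂) +
        zmode Lc (fun κ u κ' u' => (cE₂ * (Lc : ℝ) ^ (2 * (3 + 1))) •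
              mmRead Lc (K3OfK (unitK (sfStep Lc i) (smStep 3 Lc i) (KInvStep (d := 3) Lc i)) Lc
              (unitS (sfStep Lc i) (smStep 3 Lc i) (SpureRecAt 3 Lc (toSite r) cE cVH cΛ i)) (unitM (sfStep Lc i) (smStep 3 Lc i) (M1At 3 Lc (toSite r) cΛ i))
              (W2SymOfK (unitK (sfStep Lc i) (smStep 3 Lc i) (KInvStep (d := 3) Lc i)) Lc
                (unitS (sfStep Lc i) (smStep 3 Lc i) (SpureRecAt 3 Lc (toSite r) cE cVH cΛ i)) (unitM (sfStep Lc i) (smStep 3 Lc i) (M1At 3 Lc (toSite r) cΛ i)) 0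
                (unitM₂ (sfStep Lc i) (smStep 3 Lc i) (M2Of 3 Lc (mixFFAt (toSite r) Lc) i))) κ u κ' u') + cB • vh₂S κ u κ' u') κ' κ (Sum.inl κ₁) (Sum.inl κ₂) = 0))
    {CY δY CY' θY δY' : ℝ}
    (hC : ∀ (i : ℕ) (κ κ' κ₁ κ₂ : Fin (3 + 1)),
      zmode Lc (unitS₂ (sfStep Lc i) (smStep 3 Lc i) (T2RecAt 3 Lc (toSite r) cE cVH cΛ cE₂ cB Tc vh₂S (mixFFAt (toSite r) Lc) i)) κ κ' (Sum.inl κ₁) (Sum.inl κ₂)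
          + zmode Lc (unitS₂ (sfStep Lc i) (smStep 3 Lc i) (T2RecAt 3 Lc (toSite r) cE cVH cΛ cE₂ cB Tc vh₂S (mixFFAt (toSite r) Lc) i)) κ' κ (Sum.inl κ₁) (Sum.inl κ₂)
        = zmode Lc (unitS₂ (sfStep Lc i) (smStep 3 Lc i) (T2RecOf 3 Lc (fun j => KInvStep (d := 3) Lc j) (SpureRecAt 3 Lc (toSite r) cE cVH cΛ) (M1At 3 Lc (toSite r) cΛ) cE₂ cB Tc vh₂S (mixFFAt (toSite r) Lc) i)) κ κ' (Sum.inl κ₁) (Sum.inl κ₂)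
          + zmode Lc (unitS₂ (sfStep Lc i) (smStep 3 Lc i) (T2RecOf 3 Lc (fun j => KInvStep (d := 3) Lc j) (SpureRecAt 3 Lc (toSite r) cE cVH cΛ) (M1At 3 Lc (toSite r) cΛ) cE₂ cB Tc vh₂S (mixFFAt (toSite r) Lc) i)) κ' κ (Sum.inl κ₁) (Sum.inl κ₂))
    (hY : ∀ m : ℕ, LocStencil₂ ((fun κ u κ' u' => dressKBmAt (toSite r) Lc (coProjBmAtK (toSite r) Lc (fun κ₁ u₁ => coProjBmAtK (toSite r) Lc
            ((unitS₂ (sfStep Lc m) (smStep 3 Lc m) (T2RecAt 3 Lc (toSite r) cE cVH cΛ cE₂ cB Tc vh₂S (mixFFAt (toSite r) Lc) m)) κ₁ u₁) κ' u') κ u)) -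
          (unitS₂ (sfStep Lc m) (smStep 3 Lc m) (T2RecAt 3 Lc (toSite r) cE cVH cΛ cE₂ cB Tc vh₂S (mixFFAt (toSite r) Lc) m))) CY δY) (hδY : 0 < δY)
    (hYr : ∀ m : ℕ, LocStencil₂ (((fun κ u κ' u' => dressKBmAt (toSite r) Lc (coProjBmAtK (toSite r) Lc (fun κ₁ u₁ => coProjBmAtK (toSite r) Lc
            ((unitS₂ (sfStep Lc (m + 1)) (smStep 3 Lc (m + 1)) (T2RecAt 3 Lc (toSite r) cE cVH cΛ cE₂ cB Tc vh₂S (mixFFAt (toSite r) Lc) (m + 1))) κ₁ u₁) κ' u') κ u)) -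
          (unitS₂ (sfStep Lc (m + 1)) (smStep 3 Lc (m + 1)) (T2RecAt 3 Lc (toSite r) cE cVH cΛ cE₂ cB Tc vh₂S (mixFFAt (toSite r) Lc) (m + 1)))) -
      ((fun κ u κ' u' => dressKBmAt (toSite r) Lc (coProjBmAtK (toSite r) Lc (fun κ₁ u₁ => coProjBmAtK (toSite r) Lc
            ((unitS₂ (sfStep Lc m) (smStep 3 Lc m) (T2RecAt 3 Lc (toSite r) cE cVH cΛ cE₂ cB Tc vh₂S (mixFFAt (toSite r) Lc) m)) κ₁ u₁) κ' u') κ u)) -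
          (unitS₂ (sfStep Lc m) (smStep 3 Lc m) (T2RecAt 3 Lc (toSite r) cE cVH cΛ cE₂ cB Tc vh₂S (mixFFAt (toSite r) Lc) m)))) (CY' * θY ^ m) δY') (hθY0 : 0 ≤ θY) (hθY1 : θY < 1) (hδY' : 0 < δY') :
    ∃ Cw cW θW δW : ℝ, 0 ≤ θW ∧ θW < 1 ∧ 0 < δW ∧
      (∀ j : ℕ, VertexFamily₂ (unitW (sfStep Lc j) (smStep 3 Lc j)
        (WrecAt 3 Lc (toSite r) cE cVH cΛ cE₂ cB Tc vh₂S (mixFFAt (toSite r) Lc) j)) Lc Cw δW) ∧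
      (∀ k j : ℕ, VertexFamily₂ (unitW (sfStep Lc (k + j)) (smStep 3 Lc (k + j))
          (WrecAt 3 Lc (toSite r) cE cVH cΛ cE₂ cB Tc vh₂S (mixFFAt (toSite r) Lc) (k + j)) -
        unitW (sfStep Lc k) (smStep 3 Lc k) (WrecAt 3 Lc (toSite r) cE cVH cΛ cE₂ cB Tc vh₂S (mixFFAt (toSite r) Lc) k)) Lc (cW * θW ^ k) δW) := by
  obtain ⟨Ch, δh, Ch', θh, δh', hδh, hθh0, hθh1, hδh', hH, hHr⟩ := exists_hH_hHr_three_of_defect_rows hLc hr hcE cVH cΛ cE₂ cB Tc hB hδB hY hδY hYr hθY0 hθY1 hδY'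
  exact hW_hWall_WrecAt_three_of_F2a_C_H_Hr hLc hr hcE cVH cΛ cE₂ cB Tc hBff hBmm hB hδB hBt hpinEq hZ hδh hC hH hHr hθh0 hθh1 hδh'

/-! ## §2 Road FP's literal of record -/

/-- NOT IN PRINT; OUR PROOF ATTEMPT ([folklore] `exists_hH_hHr_three_of_defect_rows` at road FP's data (pinned by equations) ∘
`T2DevConservationJunction.exists_allScalesSeq_JsRowD1Pin_of_F2a_C_H_Hr`).  **ROAD FP's D1 LITERAL OF RECORD MODULO F2a-comb ∧ (C) ∧ (Q-D) ∧ (Q-D-rate)** (`Lc` odd, `Lc ≥ 2`,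
colour `N`; data `r = ctrOff 4 Lc`, `(cE, cVH, cΛ, cE₂, cB) = (Lc⁴, −Lc⁸∕2, 2∕Lc⁴, Lc⁸, −Lc¹²∕4)`, `Tc = (8N²)⁻¹ • wsym22 N`, `vh₂S = vh₂SAn1 Lc`, pinned by equations so that the four row texts
are §1's letter for letter): `∃ κ θ, 0 ≤ θ ∧ θ < 1 ∧ AllScalesSeq (j ↦ secondMoment (TbalOf Lc (JsRowD1Pin _ N) j) μ ν) κ θ`.  CONDITIONAL on the four rows ((C): an2; (Q-D)∕(Q-D-rate): the
QR-LL chain (REP) ∧ (LAY) ∧ (LT) + SLAVE-src + ι-WIN + (Q-L); F2a-comb: the comb-slot twin of W3's `zfree_bracket_an1`, unowned); NOT «D1 closed»; NEVER «G-an2-4 closed» as (CONV-C);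
NOT D1, NOT `BetaPertH`, NOT continuum, NOT Clay. -/
theorem exists_allScalesSeq_JsRowD1Pin_of_F2a_C_QD (hodd : Odd Lc) (hLc : 2 ≤ Lc) (N : ℕ) {cE cVH cΛ cE₂ cB : ℝ}
    {Tc : Fin 4 → Fin 4 → Fin 4 → Fin 4 → ℝ} {vh₂S : Tab 3}
    (hρ : r = ctrOff (3 + 1) Lc) (hcE : cE = (Lc : ℝ) ^ 4) (hcVH : cVH = -((Lc : ℝ) ^ 8 / 2)) (hcΛ : cΛ = 2 / (Lc : ℝ) ^ 4) (hcE₂ : cE₂ = (Lc : ℝ) ^ 8)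
    (hcB : cB = -((Lc : ℝ) ^ 12 / 4)) (hTc : Tc = (8 * (N : ℝ) ^ 2)⁻¹ • wsym22 N) (hvh : vh₂S = vh₂SAn1 Lc)
        (hZ : ∀ i : ℕ,
      (∀ κ u κ' u' t,
          (cE₂ * (Lc : ℝ) ^ (2 * (3 + 1))) •
              mmRead Lc (K3OfK (unitK (sfStep Lc i) (smStep 3 Lc i) (KInvStep (d := 3) Lc i)) Lc
              (unitS (sfStep Lc i) (smStep 3 Lc i) (SpureRecAt 3 Lc (toSite r) cE cVH cΛ i)) (unitM (sfStep Lc i) (smStep 3 Lc i) (M1At 3 Lc (toSite r) cΛ i))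
              (W2SymOfK (unitK (sfStep Lc i) (smStep 3 Lc i) (KInvStep (d := 3) Lc i)) Lc
                (unitS (sfStep Lc i) (smStep 3 Lc i) (SpureRecAt 3 Lc (toSite r) cE cVH cΛ i)) (unitM (sfStep Lc i) (smStep 3 Lc i) (M1At 3 Lc (toSite r) cΛ i)) 0
                (unitM₂ (sfStep Lc i) (smStep 3 Lc i) (M2Of 3 Lc (mixFFAt (toSite r) Lc) i))) κ (u + (Lc : ℤ) • t) κ' (u' + (Lc : ℤ) • t)) + cB • vh₂S κ (u + (Lc : ℤ) • t) κ' (u' + (Lc : ℤ) • t) =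
        shiftK (-((Lc : ℤ) • t)) ((cE₂ * (Lc : ℝ) ^ (2 * (3 + 1))) •
              mmRead Lc (K3OfK (unitK (sfStep Lc i) (smStep 3 Lc i) (KInvStep (d := 3) Lc i)) Lc
              (unitS (sfStep Lc i) (smStep 3 Lc i) (SpureRecAt 3 Lc (toSite r) cE cVH cΛ i)) (unitM (sfStep Lc i) (smStep 3 Lc i) (M1At 3 Lc (toSite r) cΛ i))
              (W2SymOfK (unitK (sfStep Lc i) (smStep 3 Lc i) (KInvStep (d := 3) Lc i)) Lc
                (unitS (sfStep Lc i) (smStep 3 Lc i) (SpureRecAt 3 Lc (toSite r) cE cVH cΛ i)) (unitM (sfStep Lc i) (smStep 3 Lc i) (M1At 3 Lc (toSite r) cΛ i)) 0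
                (unitM₂ (sfStep Lc i) (smStep 3 Lc i) (M2Of 3 Lc (mixFFAt (toSite r) Lc) i))) κ u κ' u') + cB • vh₂S κ u κ' u')) ∧
      (∀ κ κ' κ₁ κ₂,
        zmode Lc (fun κ u κ' u' => (cE₂ * (Lc : ℝ) ^ (2 * (3 + 1))) •
              mmRead Lc (K3OfK (unitK (sfStep Lc i) (smStep 3 Lc i) (KInvStep (d := 3) Lc i)) Lc
              (unitS (sfStep Lc i) (smStep 3 Lc i) (SpureRecAt 3 Lc (toSite r) cE cVH cΛ i)) (unitM (sfStep Lc i) (smStep 3 Lc i) (M1At 3 Lc (toSite r) cΛ i))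
              (W2SymOfK (unitK (sfStep Lc i) (smStep 3 Lc i) (KInvStep (d := 3) Lc i)) Lc
                (unitS (sfStep Lc i) (smStep 3 Lc i) (SpureRecAt 3 Lc (toSite r) cE cVH cΛ i)) (unitM (sfStep Lc i) (smStep 3 Lc i) (M1At 3 Lc (toSite r) cΛ i)) 0
                (unitM₂ (sfStep Lc i) (smStep 3 Lc i) (M2Of 3 Lc (mixFFAt (toSite r) Lc) i))) κ u κ' u') + cB • vh₂S κ u κ' u') κ κ' (Sum.inl κ₁) (Sum.inl κ₂) +
        zmode Lc (fun κ u κ' u' => (cE₂ * (Lc : ℝ) ^ (2 * (3 + 1))) •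
              mmRead Lc (K3OfK (unitK (sfStep Lc i) (smStep 3 Lc i) (KInvStep (d := 3) Lc i)) Lc
              (unitS (sfStep Lc i) (smStep 3 Lc i) (SpureRecAt 3 Lc (toSite r) cE cVH cΛ i)) (unitM (sfStep Lc i) (smStep 3 Lc i) (M1At 3 Lc (toSite r) cΛ i))
              (W2SymOfK (unitK (sfStep Lc i) (smStep 3 Lc i) (KInvStep (d := 3) Lc i)) Lc
                (unitS (sfStep Lc i) (smStep 3 Lc i) (SpureRecAt 3 Lc (toSite r) cE cVH cΛ i)) (unitM (sfStep Lc i) (smStep 3 Lc i) (M1At 3 Lc (toSite r) cΛ i)) 0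
                (unitM₂ (sfStep Lc i) (smStep 3 Lc i) (M2Of 3 Lc (mixFFAt (toSite r) Lc) i))) κ u κ' u') + cB • vh₂S κ u κ' u') κ' κ (Sum.inl κ₁) (Sum.inl κ₂) = 0))
    {CY δY CY' θY δY' : ℝ}
    (hC : ∀ (i : ℕ) (κ κ' κ₁ κ₂ : Fin (3 + 1)),
      zmode Lc (unitS₂ (sfStep Lc i) (smStep 3 Lc i) (T2RecAt 3 Lc (toSite r) cE cVH cΛ cE₂ cB Tc vh₂S (mixFFAt (toSite r) Lc) i)) κ κ' (Sum.inl κ₁) (Sum.inl κ₂)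
          + zmode Lc (unitS₂ (sfStep Lc i) (smStep 3 Lc i) (T2RecAt 3 Lc (toSite r) cE cVH cΛ cE₂ cB Tc vh₂S (mixFFAt (toSite r) Lc) i)) κ' κ (Sum.inl κ₁) (Sum.inl κ₂)
        = zmode Lc (unitS₂ (sfStep Lc i) (smStep 3 Lc i) (T2RecOf 3 Lc (fun j => KInvStep (d := 3) Lc j) (SpureRecAt 3 Lc (toSite r) cE cVH cΛ) (M1At 3 Lc (toSite r) cΛ) cE₂ cB Tc vh₂S (mixFFAt (toSite r) Lc) i)) κ κ' (Sum.inl κ₁) (Sum.inl κ₂)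
          + zmode Lc (unitS₂ (sfStep Lc i) (smStep 3 Lc i) (T2RecOf 3 Lc (fun j => KInvStep (d := 3) Lc j) (SpureRecAt 3 Lc (toSite r) cE cVH cΛ) (M1At 3 Lc (toSite r) cΛ) cE₂ cB Tc vh₂S (mixFFAt (toSite r) Lc) i)) κ' κ (Sum.inl κ₁) (Sum.inl κ₂))
    (hY : ∀ m : ℕ, LocStencil₂ ((fun κ u κ' u' => dressKBmAt (toSite r) Lc (coProjBmAtK (toSite r) Lc (fun κ₁ u₁ => coProjBmAtK (toSite r) Lc
            ((unitS₂ (sfStep Lc m) (smStep 3 Lc m) (T2RecAt 3 Lc (toSite r) cE cVH cΛ cE₂ cB Tc vh₂S (mixFFAt (toSite r) Lc) m)) κ₁ u₁) κ' u') κ u)) -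
          (unitS₂ (sfStep Lc m) (smStep 3 Lc m) (T2RecAt 3 Lc (toSite r) cE cVH cΛ cE₂ cB Tc vh₂S (mixFFAt (toSite r) Lc) m))) CY δY) (hδY : 0 < δY)
    (hYr : ∀ m : ℕ, LocStencil₂ (((fun κ u κ' u' => dressKBmAt (toSite r) Lc (coProjBmAtK (toSite r) Lc (fun κ₁ u₁ => coProjBmAtK (toSite r) Lc
            ((unitS₂ (sfStep Lc (m + 1)) (smStep 3 Lc (m + 1)) (T2RecAt 3 Lc (toSite r) cE cVH cΛ cE₂ cB Tc vh₂S (mixFFAt (toSite r) Lc) (m + 1))) κ₁ u₁) κ' u') κ u)) -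
          (unitS₂ (sfStep Lc (m + 1)) (smStep 3 Lc (m + 1)) (T2RecAt 3 Lc (toSite r) cE cVH cΛ cE₂ cB Tc vh₂S (mixFFAt (toSite r) Lc) (m + 1)))) -
      ((fun κ u κ' u' => dressKBmAt (toSite r) Lc (coProjBmAtK (toSite r) Lc (fun κ₁ u₁ => coProjBmAtK (toSite r) Lc
            ((unitS₂ (sfStep Lc m) (smStep 3 Lc m) (T2RecAt 3 Lc (toSite r) cE cVH cΛ cE₂ cB Tc vh₂S (mixFFAt (toSite r) Lc) m)) κ₁ u₁) κ' u') κ u)) -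
          (unitS₂ (sfStep Lc m) (smStep 3 Lc m) (T2RecAt 3 Lc (toSite r) cE cVH cΛ cE₂ cB Tc vh₂S (mixFFAt (toSite r) Lc) m)))) (CY' * θY ^ m) δY') (hθY0 : 0 ≤ θY) (hθY1 : θY < 1) (hδY' : 0 < δY') (μ ν : Fin 4) :
    ∃ κ θ : ℝ, 0 ≤ θ ∧ θ < 1 ∧ AllScalesSeq (fun j => B12Beta.secondMoment (TbalOf Lc (JsRowD1Pin hodd N) j) μ ν) κ θ := by
  have hcE' : cE = (Lc : ℝ) ^ (3 + 1) := by rw [hcE]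
  obtain ⟨CB, δB, hδB, hB⟩ := locStencil₂_vh₂SAn1 hodd
  have hB' : LocStencil₂ vh₂S CB δB := by rw [hvh]; exact hB
  have hr : r ∈ box (3 + 1) Lc := by rw [hρ]; exact ctrOff_mem_box (by omega)
  obtain ⟨Ch, δh, Ch', θh, δh', hδh, hθh0, hθh1, hδh', hH, hHr⟩ := exists_hH_hHr_three_of_defect_rows hLc hr hcE' cVH cΛ cE₂ cB Tc hB' hδB hY hδY hYr hθY0 hθY1 hδY'
  exact exists_allScalesSeq_JsRowD1Pin_of_F2a_C_H_Hr hodd hLc N hρ hcE hcVH hcΛ hcE₂ hcB hTc hvh hZ hδh hC hH hHr hθh0 hθh1 hδh' μ ν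

end Summit.QuantumFields.BalabanUV.Beta.GAN24.T2DevConservationCapstone

end
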